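import Summits.Ventures.CertifiedArithmetic.LowPrec.SRLaw
import HarnessLib

/-!
# Stochastic rounding into a finite format, XXIII: saturation probability only grows with the tree

HONEST FRAMING: certified error envelopes and provably optimal rounding/accumulation schemes for
low-precision formats under stated cost models; every table by two implementations; no hardware or
vendor claims.

Venture CertifiedArithmetic / lowprec, SR slice (gen5).  The exit flag of files XVIII–XIX is
sticky, so the probability that SOME node fires the exit predicate can only grow when a tree is
extended: for every substrate `F`, every exit predicate `e` and all trees `l`, `r`,

* `exitE_left_le_node`, `exitE_right_le_node`: `P(exit, l) ≤ P(exit, l ⊕ r)` and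
  `P(exit, r) ≤ P(exit, l ⊕ r)`; hence `satProbT_left_le_node` / `satProbT_right_le_node`;
* `exitE_comb_mono`: along a recursive summation `P(exit after n steps)` is nondecreasing in `n`
  (`satProbT_comb_mono`);
* combined with stochastic monotonicity (file XVIII) and the kernel row of file XIX, a LOWER bound
  valid for unknown data: **every E3M2 recursive SR sum of at least 32 terms each `≥ 1` (any
  rationals) saturates with probability at least `3260157053385 / 2^42 > 0.7412`**
  (`LawE3M2.satProb_ge_of_ge_one`); dually to the box certificate (an UPPER bound from coordinatewise
  upper bounds), coordinatewise lower bounds give lower bounds.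
-/

namespace Summit.Ventures.CertifiedArithmetic.LowPrec.SR

open Literature.ComputerArithmetic.ConnollyHighamMary2021 Finset STree

variable {K : Type*} [Field K] [LinearOrder K] [IsStrictOrderedRing K]

omit [IsStrictOrderedRing K] in
/-- A constant integrand integrates to the constant (total mass one). -/
theorem treeExpE_const (F : Finset K) (e : K → Bool) : ∀ (T : STree K) (a : K),
    treeExpE F e T (fun _ _ => a) = a
  | .leaf _, _ => rfl
  | .node l r, a => by
      simp only [treeExpE, step_const]
      rw [show (fun (_ : K) (_ : Bool) => treeExpE F e r (fun _ _ => a)) = fun _ _ => a from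
        funext fun _ => funext fun _ => treeExpE_const F e r a]
      exact treeExpE_const F e l a

/-- Indicator of a Boolean flag is monotone under `||` on the left. -/
private theorem ind_le_or_left (a b : Bool) :
    (if a then (1 : K) else 0) ≤ (if (a || b) then (1 : K) else 0) := by
  cases a <;> cases b <;> simp

/-- Indicator of a Boolean flag is monotone under `||` on the right. -/
private theorem ind_le_or_right (a b : Bool) :
    (if b then (1 : K) else 0) ≤ (if (a || b) then (1 : K) else 0) := by
  cases a <;> cases b <;> simp

/-- **The left subtree's exit probability is at most the tree's.** -/
theorem exitE_left_le_node (F : Finset K) (e : K → Bool) (l r : STree K) :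
    exitE F e l ≤ exitE F e (.node l r) := by
  unfold exitE
  simp only [treeExpE]
  calc treeExpE F e l (fun _ fl => if fl then (1 : K) else 0)
      = treeExpE F e l (fun a fa => treeExpE F e r (fun b _ =>
          step F (a + b) (fun _ => if fa then (1 : K) else 0))) := by
        refine treeExpE_congr F e l (fun a fa => ?_)
        simp only [step_const]
        exact (treeExpE_const F e r _).symm
    _ ≤ _ := by
        refine treeExpE_mono F e l (fun a fa => treeExpE_mono F e r (fun b fb =>
          step_mono F _ (fun _ => ?_)))
        rw [Bool.or_assoc]
        exact ind_le_or_left _ _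

/-- **The right subtree's exit probability is at most the tree's.** -/
theorem exitE_right_le_node (F : Finset K) (e : K → Bool) (l r : STree K) :
    exitE F e r ≤ exitE F e (.node l r) := by
  unfold exitE
  simp only [treeExpE]
  calc treeExpE F e r (fun _ fl => if fl then (1 : K) else 0)
      = treeExpE F e l (fun a _ => treeExpE F e r (fun b fb =>
          step F (a + b) (fun _ => if fb then (1 : K) else 0))) := by
        simp only [step_const]
        exact (treeExpE_const F e l _).symm
    _ ≤ _ := by
        refine treeExpE_mono F e l (fun a fa => treeExpE_mono F e r (fun b fb =>
          step_mono F _ (fun _ => ?_)))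
        calc (if fb then (1 : K) else 0) ≤ if (fa || fb) then (1 : K) else 0 := ind_le_or_right _ _
          _ ≤ if (fa || fb || e (a + b)) then (1 : K) else 0 := ind_le_or_left _ _

/-- Saturation probability of a subtree is at most the tree's (left). -/
theorem satProbT_left_le_node {F : Finset K} {lo hi : K} (hlo : lo ∈ F) (hhi : hi ∈ F)
    (hb : ∀ y ∈ F, lo ≤ y ∧ y ≤ hi) (l r : STree K) :
    satProbT F l ≤ satProbT F (.node l r) := by
  rw [satProbT_eq_exitE hlo hhi hb, satProbT_eq_exitE hlo hhi hb]
  exact exitE_left_le_node F _ l r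

/-- Saturation probability of a subtree is at most the tree's (right). -/
theorem satProbT_right_le_node {F : Finset K} {lo hi : K} (hlo : lo ∈ F) (hhi : hi ∈ F)
    (hb : ∀ y ∈ F, lo ≤ y ∧ y ≤ hi) (l r : STree K) :
    satProbT F r ≤ satProbT F (.node l r) := by
  rw [satProbT_eq_exitE hlo hhi hb, satProbT_eq_exitE hlo hhi hb]
  exact exitE_right_le_node F _ l r

/-- **Along a recursive summation the exit probability is nondecreasing in the number of steps.** -/
theorem exitE_comb_mono (F : Finset K) (e : K → Bool) (x : ℕ → K) (s : K) {n n' : ℕ}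
    (h : n ≤ n') : exitE F e (comb x s n) ≤ exitE F e (comb x s n') := by
  induction h with
  | refl => exact le_rfl
  | step _ ih => exact ih.trans (exitE_left_le_node F e _ _)

/-- `P(sat)` is nondecreasing along a recursive summation. -/
theorem satProbT_comb_mono {F : Finset K} {lo hi : K} (hlo : lo ∈ F) (hhi : hi ∈ F)
    (hb : ∀ y ∈ F, lo ≤ y ∧ y ≤ hi) (x : ℕ → K) (s : K) {n n' : ℕ} (h : n ≤ n') :
    satProbT F (comb x s n) ≤ satProbT F (comb x s n') := by
  rw [satProbT_eq_exitE hlo hhi hb, satProbT_eq_exitE hlo hhi hb]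
  exact exitE_comb_mono F _ x s h

/-- **Lower box bound**: coordinatewise LOWER bounds on the data give a LOWER bound on `P(sat)` via
the upper-exit probability of the lower corner, for every longer recursive summation. -/
theorem corner_le_satProbT {F : Finset K} {lo hi : K} (hlo : lo ∈ F) (hhi : hi ∈ F)
    (hb : ∀ y ∈ F, lo ≤ y ∧ y ≤ hi) {x y : ℕ → K} {s t : K} (hs : s ≤ t) (hxy : ∀ i, x i ≤ y i)
    {n n' : ℕ} (h : n ≤ n') :
    exitE F (fun c => decide (hi < c)) (comb x s n) ≤ satProbT F (comb y t n') :=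
  ((exitE_comb_mono F _ x s h).trans (exitE_mono_leaves ⟨lo, hlo⟩ hi (leafLE_comb hs hxy n'))).trans
    (exitE_upper_le_satProbT hlo hhi hb _)

namespace LawE3M2

/-- **E3M2: every recursive SR sum of at least 32 terms each `≥ 1` (arbitrary rationals, e.g. counts
or magnitudes `≥ 1`) saturates with probability at least `3260157053385 / 2^42 ≈ 0.74127`.** -/
theorem satProb_ge_of_ge_one (x : ℕ → ℚ) (s : ℚ) (hs : 1 ≤ s) (hx : ∀ i, 1 ≤ x i) {n : ℕ}
    (hn : 31 ≤ n) : 3260157053385 / 4398046511104 ≤ satProbT Formats.e3m2 (comb x s n) := by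
  obtain ⟨hlo, hhi, _, hb⟩ := e3m2_hull
  have h := corner_le_satProbT hlo hhi hb (x := fun _ => (1 : ℚ)) (s := 1) hs hx hn
  rwa [cornerUp_eq, cornerUp_31] at h

/-- And of at least 24 terms `≥ 1`: at least `18112973 / 2^26 ≈ 0.2699`; of at least 16: `≥ 1/1024`. -/
theorem satProb_ge_of_ge_one_24 (x : ℕ → ℚ) (s : ℚ) (hs : 1 ≤ s) (hx : ∀ i, 1 ≤ x i) {n : ℕ}
    (hn : 23 ≤ n) : 18112973 / 67108864 ≤ satProbT Formats.e3m2 (comb x s n) := by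
  obtain ⟨hlo, hhi, _, hb⟩ := e3m2_hull
  have h := corner_le_satProbT hlo hhi hb (x := fun _ => (1 : ℚ)) (s := 1) hs hx hn
  rwa [cornerUp_eq, cornerUp_23] at h

end LawE3M2

end Summit.Ventures.CertifiedArithmetic.LowPrec.SR
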